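import Summits.Ventures.PercRepro.C041SixVec

/-!
# ROW C-041 — THE MARKED POINT: a single vertex with `p` 1-marks and `q` 2-marks, its six-vector is the pure vector
`V(1^p, 0^q)` (p6, gen 29; mine-3's C-041.md §19 (a), (j): «marks are children», `X(p, q) = V(1^p 0^q)`)

`pointZone p q` is the zone with one vertex, no edge, `p` 1-marks and `q` 2-marks at the vertex.  Its six-vector at
the vertex is `(1, 2^p, 2^q, [p = q = 0], [q = 0], [p = 0])` (`sixVec_pointZone`) — the pure vector
`v 1 ^ p * v 0 ^ q` of mine-3's cone (`C041TreeClosure`), so it lies in the cone (`inCone_sixVec_pointZone`): the SEED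
of the class generated by pendant attachment and gluing at the anchor (`C041PendantCone`, `C041AnchorGlueSix`).
-/

namespace PercRepro

namespace ZoneZ

namespace PointZone

open ZoneData TreeClosure Finset

/-- THE MARKED POINT: one vertex, no edge, `p` 1-marks and `q` 2-marks. -/
def pointZone (p q : ℕ) : ZoneData Unit Empty (Fin p) (Fin q) :=
  ⟨Empty.elim, Empty.elim, fun _ => (), fun _ => ()⟩

variable (p q : ℕ)

/-- Nothing is adjacent in a zone without edges. -/
theorem not_adj (cond : Empty → Bool → Prop) (σ : State Empty (Fin p) (Fin q)) (x y : Unit) :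
    ¬ (pointZone p q).Adj cond σ x y := by
  rintro ⟨e, -, -⟩
  exact e.elim

/-- The reach of a set in a zone without edges is the set. -/
theorem reach_eq (cond : Empty → Bool → Prop) (σ : State Empty (Fin p) (Fin q)) (S : Set Unit) :
    reach ((pointZone p q).Adj cond σ) S = S := by
  ext x
  constructor
  · rintro ⟨s, hs, hsx⟩
    cases hsx with
    | refl => exact hs
    | tail _ h => exact (not_adj p q cond σ _ _ h).elim
  · exact fun h => mem_reach_of_mem h

/-- The vertex carries a blue `1`-mark iff some `1`-mark is blue. -/
theorem mem_markSet_iff {T : Type*} (m : T → Bool) (b : Bool) :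
    () ∈ markSet (fun _ : T => ()) m b ↔ ∃ t, m t = b := by
  unfold markSet
  constructor
  · rintro ⟨t, -, hm⟩
    exact ⟨t, hm⟩
  · rintro ⟨t, hm⟩
    exact ⟨t, rfl, hm⟩

/-- The vertex is deleted iff some `1`-mark is blue. -/
theorem mem_D_iff (σ : State Empty (Fin p) (Fin q)) : () ∈ (pointZone p q).D σ ↔ ∃ i, σ.2.1 i = false := by
  unfold D BlueAdj
  rw [reach_eq]
  exact mem_markSet_iff σ.2.1 false

/-- The vertex is deleted on side `2` iff some `2`-mark is blue. -/
theorem mem_D2_iff (σ : State Empty (Fin p) (Fin q)) : () ∈ (pointZone p q).D2 σ ↔ ∃ i, σ.2.2 i = false := by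
  unfold D2 BlueAdj
  rw [reach_eq]
  exact mem_markSet_iff σ.2.2 false

/-- Admissible: not both a blue `1`-mark and a blue `2`-mark. -/
theorem adm_iff (σ : State Empty (Fin p) (Fin q)) :
    (pointZone p q).adm σ ↔ ¬ ((∃ i, σ.2.1 i = false) ∧ ∃ i, σ.2.2 i = false) := by
  unfold adm
  rw [Set.disjoint_left]
  constructor
  · rintro h ⟨h1, h2⟩
    exact h ((mem_markSet_iff σ.2.2 false).2 h2) ((mem_D_iff p q σ).2 h1)
  · intro h x hM hD
    exact h ⟨(mem_D_iff p q σ).1 hD, (mem_markSet_iff σ.2.2 false).1 hM⟩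

/-- Blue at `K` (the vertex): every mark is blue. -/
theorem blueK_iff (σ : State Empty (Fin p) (Fin q)) :
    (pointZone p q).blueK {()} σ ↔ (∀ i, σ.2.1 i = false) ∧ ∀ i, σ.2.2 i = false := by
  unfold blueK K RedAdj
  rw [reach_eq, Set.disjoint_left]
  constructor
  · intro h
    refine ⟨fun i => ?_, fun i => ?_⟩
    · by_contra hi
      exact h rfl (Or.inl ((mem_markSet_iff σ.2.1 true).2 ⟨i, by simpa using hi⟩))
    · by_contra hi
      exact h rfl (Or.inr ((mem_markSet_iff σ.2.2 true).2 ⟨i, by simpa using hi⟩))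
  · rintro ⟨h1, h2⟩ x - hx
    rcases hx with hx | hx
    · obtain ⟨i, hi⟩ := (mem_markSet_iff σ.2.1 true).1 hx
      rw [h1 i] at hi
      exact Bool.noConfusion hi
    · obtain ⟨i, hi⟩ := (mem_markSet_iff σ.2.2 true).1 hx
      rw [h2 i] at hi
      exact Bool.noConfusion hi

/-! ## Counting -/

/-- A filter on a product by a conjunction of conditions on the factors. -/
theorem card_filter_prod {α β : Type*} [Fintype α] [Fintype β] (P : α → Prop) (Q : β → Prop)
    [DecidablePred P] [DecidablePred Q] :
    #(univ.filter fun x : α × β => P x.1 ∧ Q x.2) = #(univ.filter P) * #(univ.filter Q) := by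
  rw [← Finset.univ_product_univ, Finset.filter_product, Finset.card_product]

/-- All marks red iff no mark is blue. -/
theorem forall_true_iff_not_exists_false {T : Type*} (m : T → Bool) :
    (∀ t, m t = true) ↔ ¬ ∃ t, m t = false := by
  simp only [not_exists, Bool.not_eq_false]

/-- The colourings of no edge: one. -/
theorem card_empty_col : #((univ : Finset (Empty → Bool)).filter fun _ => True) = 1 := by
  rw [Finset.filter_true_of_mem (fun _ _ => trivial), Finset.card_univ, Fintype.card_fun, Fintype.card_empty,
    pow_zero]

/-- The all-red colouring of `n` marks is unique. -/
theorem card_allRed (n : ℕ) : #((univ : Finset (Fin n → Bool)).filter fun m => ∀ i, m i = true) = 1 := by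
  rw [Finset.card_eq_one]
  refine ⟨fun _ => true, ?_⟩
  ext m
  simp only [Finset.mem_filter, Finset.mem_univ, true_and, Finset.mem_singleton, funext_iff]

/-- The all-blue colouring of `n` marks is unique. -/
theorem card_allBlue (n : ℕ) : #((univ : Finset (Fin n → Bool)).filter fun m => ∀ i, m i = false) = 1 := by
  rw [Finset.card_eq_one]
  refine ⟨fun _ => false, ?_⟩
  ext m
  simp only [Finset.mem_filter, Finset.mem_univ, true_and, Finset.mem_singleton, funext_iff]

/-- All colourings of `n` marks: `2^n`. -/
theorem card_all (n : ℕ) : #((univ : Finset (Fin n → Bool)).filter fun _ => True) = 2 ^ n := by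
  rw [Finset.filter_true_of_mem (fun _ _ => trivial), Finset.card_univ, Fintype.card_fun, Fintype.card_bool,
    Fintype.card_fin]

/-- The all-red and all-blue colouring of `n` marks: one iff `n = 0`. -/
theorem card_allRed_allBlue (n : ℕ) :
    #((univ : Finset (Fin n → Bool)).filter fun m => (∀ i, m i = true) ∧ ∀ i, m i = false) =
      if n = 0 then 1 else 0 := by
  by_cases hn : n = 0
  · subst hn
    rw [if_pos rfl, Finset.card_eq_one]
    refine ⟨fun i => i.elim0, ?_⟩
    ext m
    simp only [Finset.mem_filter, Finset.mem_univ, true_and, Finset.mem_singleton, funext_iff]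
    constructor
    · intro _
      exact fun i => i.elim0
    · intro _
      exact ⟨fun i => i.elim0, fun i => i.elim0⟩
  · rw [if_neg hn, Finset.card_eq_zero, Finset.filter_eq_empty_iff]
    rintro m - ⟨h1, h2⟩
    have h := h1 ⟨0, Nat.pos_of_ne_zero hn⟩
    rw [h2] at h
    exact Bool.noConfusion h

/-- A state of the point is its two mark patterns (the edge colouring is trivial): the six counts. -/
theorem card_state (P : (Fin p → Bool) → Prop) (Q : (Fin q → Bool) → Prop) [DecidablePred P] [DecidablePred Q] :
    #((univ : Finset (State Empty (Fin p) (Fin q))).filter fun σ => P σ.2.1 ∧ Q σ.2.2) =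
      #(univ.filter P) * #(univ.filter Q) := by
  have h := card_filter_prod (α := Empty → Bool) (β := (Fin p → Bool) × (Fin q → Bool)) (fun _ => True)
    (fun m => P m.1 ∧ Q m.2)
  rw [card_empty_col, one_mul, card_filter_prod P Q] at h
  rw [← h]
  congr 1
  ext σ
  simp only [Finset.mem_filter, Finset.mem_univ, true_and]

/-- `#F = 1`. -/
theorem card_Fset : #((pointZone p q).Fset ()) = 1 := by
  classical
  have e : (pointZone p q).Fset () = univ.filter fun σ : State Empty (Fin p) (Fin q) =>
      (∀ i, σ.2.1 i = true) ∧ ∀ i, σ.2.2 i = true := by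
    ext σ
    rw [mem_Fset, Finset.mem_filter, adm_iff, mem_D_iff, mem_D2_iff, forall_true_iff_not_exists_false,
      forall_true_iff_not_exists_false]
    simp only [Finset.mem_univ, true_and]
    tauto
  rw [e, card_state p q (fun m => ∀ i, m i = true) (fun m => ∀ i, m i = true), card_allRed, card_allRed]

/-- `#(F + T₁) = 2^p`. -/
theorem card_FAset : #((pointZone p q).FAset ()) = 2 ^ p := by
  classical
  have e : (pointZone p q).FAset () = univ.filter fun σ : State Empty (Fin p) (Fin q) =>
      True ∧ ∀ i, σ.2.2 i = true := by
    ext σ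
    rw [mem_FAset, Finset.mem_filter, adm_iff, mem_D2_iff, forall_true_iff_not_exists_false]
    simp only [Finset.mem_univ, true_and]
    tauto
  rw [e, card_state p q (fun _ => True) (fun m => ∀ i, m i = true), card_all, card_allRed, mul_one]

/-- `#(F + T₂) = 2^q`. -/
theorem card_FBset : #((pointZone p q).FBset ()) = 2 ^ q := by
  classical
  have e : (pointZone p q).FBset () = univ.filter fun σ : State Empty (Fin p) (Fin q) =>
      (∀ i, σ.2.1 i = true) ∧ True := by
    ext σ
    rw [mem_FBset, Finset.mem_filter, adm_iff, mem_D_iff, forall_true_iff_not_exists_false]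
    simp only [Finset.mem_univ, true_and]
    tauto
  rw [e, card_state p q (fun m => ∀ i, m i = true) (fun _ => True), card_allRed, card_all, one_mul]

/-- `#I_F = [p = q = 0]`. -/
theorem card_IFset : #((pointZone p q).IFset ()) = if p = 0 ∧ q = 0 then 1 else 0 := by
  classical
  have e : (pointZone p q).IFset () = univ.filter fun σ : State Empty (Fin p) (Fin q) =>
      ((∀ i, σ.2.1 i = true) ∧ ∀ i, σ.2.1 i = false) ∧ ((∀ i, σ.2.2 i = true) ∧ ∀ i, σ.2.2 i = false) := by
    ext σ
    rw [mem_IFset, Finset.mem_filter, adm_iff, blueK_iff, mem_D_iff, mem_D2_iff, forall_true_iff_not_exists_false,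
      forall_true_iff_not_exists_false]
    simp only [Finset.mem_univ, true_and]
    tauto
  rw [e, card_state p q (fun m => (∀ i, m i = true) ∧ ∀ i, m i = false)
    (fun m => (∀ i, m i = true) ∧ ∀ i, m i = false), card_allRed_allBlue, card_allRed_allBlue]
  by_cases hp : p = 0 <;> by_cases hq : q = 0 <;> simp [hp, hq]

/-- `#(I_F + I₁) = [q = 0]`. -/
theorem card_IAset : #((pointZone p q).IAset ()) = if q = 0 then 1 else 0 := by
  classical
  have e : (pointZone p q).IAset () = univ.filter fun σ : State Empty (Fin p) (Fin q) =>
      (∀ i, σ.2.1 i = false) ∧ ((∀ i, σ.2.2 i = true) ∧ ∀ i, σ.2.2 i = false) := by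
    ext σ
    rw [mem_IAset, Finset.mem_filter, adm_iff, blueK_iff, mem_D2_iff, forall_true_iff_not_exists_false]
    simp only [Finset.mem_univ, true_and]
    tauto
  rw [e, card_state p q (fun m => ∀ i, m i = false) (fun m => (∀ i, m i = true) ∧ ∀ i, m i = false),
    card_allBlue, card_allRed_allBlue, one_mul]

/-- `#(I_F + I₂) = [p = 0]`. -/
theorem card_IBset : #((pointZone p q).IBset ()) = if p = 0 then 1 else 0 := by
  classical
  have e : (pointZone p q).IBset () = univ.filter fun σ : State Empty (Fin p) (Fin q) =>
      ((∀ i, σ.2.1 i = true) ∧ ∀ i, σ.2.1 i = false) ∧ ∀ i, σ.2.2 i = false := by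
    ext σ
    rw [mem_IBset, Finset.mem_filter, adm_iff, blueK_iff, mem_D_iff, forall_true_iff_not_exists_false]
    simp only [Finset.mem_univ, true_and]
    tauto
  rw [e, card_state p q (fun m => (∀ i, m i = true) ∧ ∀ i, m i = false) (fun m => ∀ i, m i = false),
    card_allRed_allBlue, card_allBlue, mul_one]

/-! ## The pure vector -/

/-- The coordinates of `v 1 ^ p * v 0 ^ q`. -/
theorem vpow_apply :
    ((1 : Vec6) * v 1 ^ p * v 0 ^ q) 0 = 1 ∧ ((1 : Vec6) * v 1 ^ p * v 0 ^ q) 1 = 2 ^ p ∧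
    ((1 : Vec6) * v 1 ^ p * v 0 ^ q) 2 = 2 ^ q ∧ ((1 : Vec6) * v 1 ^ p * v 0 ^ q) 3 = (0 : ℝ) ^ p * 0 ^ q ∧
    ((1 : Vec6) * v 1 ^ p * v 0 ^ q) 4 = (0 : ℝ) ^ q ∧ ((1 : Vec6) * v 1 ^ p * v 0 ^ q) 5 = (0 : ℝ) ^ p := by
  refine ⟨?_, ?_, ?_, ?_, ?_, ?_⟩ <;> simp [v, Pi.pow_apply, one_add_one_eq_two]

/-- The pure vector `V(1^p, 0^q)` lies in the cone. -/
theorem inCone_vpow : InCone ((1 : Vec6) * v 1 ^ p * v 0 ^ q) :=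
  (InCone_one.mul_pow_v zero_le_one le_rfl p).mul_pow_v le_rfl zero_le_one q

/-- **The six-vector of the marked point is the pure vector `V(1^p, 0^q)`.** -/
theorem sixVec_pointZone : (pointZone p q).sixVec () = (1 : Vec6) * v 1 ^ p * v 0 ^ q := by
  obtain ⟨h0, h1, h2, h3, h4, h5⟩ := vpow_apply p q
  funext i
  fin_cases i
  · show (pointZone p q).sixVec () 0 = ((1 : Vec6) * v 1 ^ p * v 0 ^ q) 0
    rw [sixVec_zero, card_Fset, h0]
    simp
  · show (pointZone p q).sixVec () 1 = ((1 : Vec6) * v 1 ^ p * v 0 ^ q) 1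
    rw [sixVec_one, card_FAset, h1]
    simp
  · show (pointZone p q).sixVec () 2 = ((1 : Vec6) * v 1 ^ p * v 0 ^ q) 2
    rw [sixVec_two, card_FBset, h2]
    simp
  · show (pointZone p q).sixVec () 3 = ((1 : Vec6) * v 1 ^ p * v 0 ^ q) 3
    rw [sixVec_three, card_IFset, h3, zero_pow_ite, zero_pow_ite]
    by_cases hp : p = 0 <;> by_cases hq : q = 0 <;> simp [hp, hq]
  · show (pointZone p q).sixVec () 4 = ((1 : Vec6) * v 1 ^ p * v 0 ^ q) 4
    rw [sixVec_four, card_IAset, h4, zero_pow_ite]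
    by_cases hq : q = 0 <;> simp [hq]
  · show (pointZone p q).sixVec () 5 = ((1 : Vec6) * v 1 ^ p * v 0 ^ q) 5
    rw [sixVec_five, card_IBset, h5, zero_pow_ite]
    by_cases hp : p = 0 <;> simp [hp]

/-- **THE SEED**: the six-vector of the marked point lies in the cone. -/
theorem inCone_sixVec_pointZone : InCone ((pointZone p q).sixVec ()) := by
  rw [sixVec_pointZone]
  exact inCone_vpow p q

end PointZone

end ZoneZ

end PercRepro
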